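import Mathlib
import Summits.ValiantsHypothesis.ValiantsHypothesis.Theorems.DivisionGapDefs

/-!
# `DivisionGap.PerCofactorDegreeReduction` (stmt-ValiantsHypothesis-15046), line `Sketch_ideator4`:
dominant self-isolation (stub `stub_dominantSelfIsolation`, J)

A monomial `u` of the multiplier `h` (over `ℝ≥0`) is DOMINANT if it attains the maximal exponent
of `h` on every cell of its support (`∀ v ∈ supp h, ∀ e ∈ supp u, v e ≤ u e`).  If moreover `h`
is homogeneous of the total degree of `u` (`∀ v ∈ supp h, deg v = deg u`), then `u` is the ONLY
monomial of `h` supported inside `supp u`, i.e. `u` is isolated in its own support (the host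
`G = supp u` of the isolated-strip theorem `IsolatedStrip.stub_isolatedStrip`):

* a monomial `v` with `supp v ⊆ supp u` satisfies `v ≤ u` pointwise (`Finsupp.le_iff`: only the
  cells of `supp v ⊆ supp u` matter, and there dominance applies);
* `v ≤ u` and `deg v = deg u` force `v = u`: `u = v + (u - v)` (`add_tsub_cancel_of_le`), the
  degree is additive, so `deg (u - v) = 0`, whence `u - v = 0` (`Finsupp.degree_eq_zero_iff`).

No definitions in this file. [folklore]
-/

noncomputable section

-- `Summit.ValiantsHypothesis.ValiantsHypothesis.…` is the tree's mandated single-conjunct layout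
-- (Sub = Summit), so the duplicated namespace component is intended.
set_option linter.dupNamespace false

open MvPolynomial Literature.Computability.AlgebraicComplexity
open scoped NNReal

namespace Summit.ValiantsHypothesis.ValiantsHypothesis.Theorems.DivisionGap.PerCofactorDegreeReduction.DominantSelfIsolation

/-- If `v` is dominated by `u` on `supp u` and `supp v ⊆ supp u`, then `v ≤ u` pointwise.
[folklore] -/
theorem le_of_dominated {σ : Type*} {u v : σ →₀ ℕ}
    (hdom : ∀ e ∈ u.support, v e ≤ u e) (hsub : v.support ⊆ u.support) : v ≤ u :=
  (Finsupp.le_iff v u).2 fun e he => hdom e (hsub he)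

/-- Two exponent vectors with `v ≤ u` pointwise and the same total degree are equal:
`u = v + (u - v)` and additivity of the degree give `deg (u - v) = 0`, so `u - v = 0`.
[folklore] -/
theorem eq_of_le_of_degree_eq {σ : Type*} {u v : σ →₀ ℕ} (hle : v ≤ u)
    (hdeg : v.degree = u.degree) : v = u := by
  have hsplit : v + (u - v) = u := add_tsub_cancel_of_le hle
  have hzero : (u - v).degree = 0 := by
    have hd := congr_arg Finsupp.degree hsplit
    rw [map_add, hdeg] at hd
    omega
  rw [(Finsupp.degree_eq_zero_iff _).1 hzero, add_zero] at hsplit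
  exact hsplit

/-- **Dominant self-isolation (stub `stub_dominantSelfIsolation`, J, of line `Sketch_ideator4`).**
If all monomials of `h` have the total degree of `u` and `u` dominates every monomial of `h` on
`supp u`, then `u` is the only monomial of `h` supported inside `supp u`: such a monomial `v`
satisfies `v ≤ u` pointwise (`le_of_dominated`), and `v ≤ u` with `deg v = deg u` forces `v = u`
(`eq_of_le_of_degree_eq`). [folklore] -/
theorem stub_dominantSelfIsolation :
    ∀ (n : ℕ) (h : MvPolynomial (Fin n × Fin n) ℝ≥0) (u : (Fin n × Fin n) →₀ ℕ),
      u ∈ h.support →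
      (∀ v ∈ h.support, v.degree = u.degree) →
      (∀ v ∈ h.support, ∀ e ∈ u.support, v e ≤ u e) →
      ∀ v ∈ h.support, v.support ⊆ u.support → v = u :=
  fun _ _ _ _ hdeg hdom v hv hsub =>
    eq_of_le_of_degree_eq (le_of_dominated (hdom v hv) hsub) (hdeg v hv)

end Summit.ValiantsHypothesis.ValiantsHypothesis.Theorems.DivisionGap.PerCofactorDegreeReduction.DominantSelfIsolation

end
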